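import Summits.Ventures.Crystal3D.Theorems.StickyWulffConstantTextureLiminfTexShadowSplitDefs
import Summits.Ventures.Crystal3D.Theorems.StickyWulffConstantTextureLiminfTexShadowCoverableDefs
import HarnessLib

/-!
# TexShadow v6.10 §2c — Barlow coverability and the THREE-WAY split of the generic wall part, VERBATIM (definitions of record)
# (lane T, crux `TextureLiminf`, stmt-Ventures-19483; cf-p1 ROUTE.md §86(77) BT DECISION (xxxvii), §86(87) CD, option (a) of 17:35:35Z)

HONEST FRAMING. Venture `Summits/Ventures/Crystal3D` (cell `crystal3d-full`), helper `--supports` the crux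
`TextureLiminf` (stmt-Ventures-19483) of `route-Ventures-StickyWulffConstant`, registered line `TexShadow`.  Rung credit
only; F-C1 not moved.  DEFINITIONS ONLY (plus one proved glue lemma); NOT the wall law's proof.

This file is the tree copy of the planner's skeleton §2c (HOME/cf-p1/route/lines/tex/TexShadowV69.lean) AFTER the v6.10
import swap of record (cf-p1 17:35:35Z, option (a) of 19480-p2 17:35:16Z): the provisional local `upFrame` / `upWord` /
`DeltaSteep` / `plateReach` are replaced by the tree's `…TexShadowCoverableDefs` (19480-p2 p652360: `upFrame`, `upWord`,
`famSlot`, `DeltaSteep`, `BarlowOffReach`), and Barlow coverability is PINNED to the deterministic family slots: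

* `BarlowCoverable L₁ s₁ σ₁ L₂ s₂ σ₂ := DeltaSteep L₁ e₃ ∧ DeltaSteep L₂ (−e₃) ∧ BarlowOffReach L₁ s₁ σ₁ L₂ s₂ σ₂`
  (O1–O3 at `famSlot`; exactly the hypotheses `hsteep₁/hsteep₂/hoff₁/hoff₂/hdisjR` of lane G's F4
  `barlow_lineCount_le_payers` for the up-presentations);
* `BilayerWallWalkerCovered C R₀` [generic ∧ BarlowCoverable ∧ FluxDominated (√2/2) ⇒ `BilayerWallAt`] — the target of F4 +
  E1 + StarPairFar by name (T-side glue: `…TexShadowWalkerCoveredGlue`);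
* `BilayerWallOnReach C R₀` [generic, both plates Δ-steep, NOT Barlow-coverable] — T's analogue of lane F (co-axial /
  co-Barlow plate pairs incl. R45's binding half-cell translation wall, point-registered and Barlow Σ9 / separated-wide cells);
* `BilayerWallDeficient C R₀` [generic, not both Δ-steep, or coverable with a table NOT flux-dominated] — the orientation /
  table-deficient remainder (LAYER-FLUX tables with MAX + the (L3) certificate road of DECISION (xxxvi));
* the `…From R` versions and the proved glue `bilayerWallGeneric_of_three` (verbatim v6.9: two `by_cases`).
`BilayerFramesAt`, `InResidualClass`, `BilayerChargeAdmissible`, `BilayerWallGenericFrom` are `…TexShadowSplitDefs` (p648874);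
`BilayerWallAt`, `bilayerWallAt_mono` are `…TexShadowWallDefs` (p639692); `FluxDominated` is `…TexShadowFluxDefs` (p641847).
WHAT THIS IS NOT: no proof of any wall law; which pairs are coverable is lane F/T analysis; F-C1 not moved.
-/

noncomputable section

open scoped BigOperators InnerProductSpace ENNReal
open MeasureTheory Filter

namespace Summit.Ventures.Crystal3D.Cruxes.TextureLiminf.TexShadow

open Summit.Ventures.Crystal3D
open Literature.MathematicalPhysics.StatisticalMechanics (IsHaggSeq)

/-! ## §2c (v6.10) Barlow coverability, pinned to the family slots -/

/-- **BARLOW COVERABILITY** of a facing plate pair (bottom plate `(L₁, s₁, σ₁)` walked toward `e₃`, top plate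
`(L₂, s₂, σ₂)` toward `−e₃`), option (a) of record: both plates Δ-STEEP (so their family slots `famSlot` are steep,
`famSlot_steep_of_deltaSteep`) and BARLOW OFF-REACH at the family slots (O1 ∧ O2 ∧ O3 of `BarlowOffReach`) — exactly the
hypotheses `hsteep₁ / hsteep₂ / hoff₁ / hoff₂ / hdisjR` of lane G's F4 (`barlow_lineCount_le_payers`, 19480-p2 p652077) for the
up-presentations `(upFrame Lᵢ zᵢ, upWord Lᵢ σᵢ zᵢ)`, `z₁ = e₃`, `z₂ = −e₃`. -/
def BarlowCoverable (L₁ : E3 ≃ₗᵢ[ℝ] E3) (s₁ : E3) (σ₁ : ℤ → ℤ) (L₂ : E3 ≃ₗᵢ[ℝ] E3) (s₂ : E3) (σ₂ : ℤ → ℤ) :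
    Prop :=
  DeltaSteep L₁ e₃ ∧ DeltaSteep L₂ (-e₃) ∧ BarlowOffReach L₁ s₁ σ₁ L₂ s₂ σ₂

/-! ## §2c (v6.9/v6.10) The three-way split of the generic part -/

/-- **WALKER-COVERED PART of the generic wall law at `(C, R₀)`** (v6.9): generic (non-residual) plate pairs that are
BARLOW-COVERABLE, with FLUX-DOMINATED admissible tables — the target of F4 + E1 + StarPairFar by name. -/
def BilayerWallWalkerCovered (C R₀ : ℝ) : Prop :=
  ∀ (σ₁ σ₂ : ℤ → ℤ), IsHaggSeq σ₁ → IsHaggSeq σ₂ →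
    ∀ (L₁ L₂ : E3 ≃ₗᵢ[ℝ] E3) (s₁ s₂ : E3) (A₁ A₂ : ℤ → (E3 ≃ₗᵢ[ℝ] E3)) (u₁ u₂ : ℤ → E3),
    BilayerFramesAt L₁ s₁ σ₁ A₁ u₁ → BilayerFramesAt L₂ s₂ σ₂ A₂ u₂ →
    (∀ i j : ℤ, ¬ InResidualClass (A₁ i) (A₂ j) (u₁ i) (u₂ j)) →
    BarlowCoverable L₁ s₁ σ₁ L₂ s₂ σ₂ →
    ∀ (c : ℤ → ℤ → ℝ) (m : ℤ → ℤ → E3), BilayerChargeAdmissible A₁ A₂ c m →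
      FluxDominated (Real.sqrt 2 / 2) L₁ σ₁ L₂ σ₂ c →
      BilayerWallAt C R₀ σ₁ σ₂ L₁ L₂ s₁ s₂ c

/-- **ON-REACH PART of the generic wall law at `(C, R₀)`** (v6.9; NEW named residual = T's analogue of lane F): generic
plate pairs BOTH Δ-steep but NOT Barlow-coverable — the family slot pair is reach-obstructed (co-axial / co-Barlow
plate pairs incl. R45's binding half-cell translation wall, point-registered and Barlow Σ9 / separated-wide cells).  Under
both-steepness `¬ BarlowCoverable` reads `¬ BarlowOffReach`. -/
def BilayerWallOnReach (C R₀ : ℝ) : Prop :=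
  ∀ (σ₁ σ₂ : ℤ → ℤ), IsHaggSeq σ₁ → IsHaggSeq σ₂ →
    ∀ (L₁ L₂ : E3 ≃ₗᵢ[ℝ] E3) (s₁ s₂ : E3) (A₁ A₂ : ℤ → (E3 ≃ₗᵢ[ℝ] E3)) (u₁ u₂ : ℤ → E3),
    BilayerFramesAt L₁ s₁ σ₁ A₁ u₁ → BilayerFramesAt L₂ s₂ σ₂ A₂ u₂ →
    (∀ i j : ℤ, ¬ InResidualClass (A₁ i) (A₂ j) (u₁ i) (u₂ j)) →
    DeltaSteep L₁ e₃ → DeltaSteep L₂ (-e₃) → ¬ BarlowCoverable L₁ s₁ σ₁ L₂ s₂ σ₂ →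
    ∀ (c : ℤ → ℤ → ℝ) (m : ℤ → ℤ → E3), BilayerChargeAdmissible A₁ A₂ c m →
      BilayerWallAt C R₀ σ₁ σ₂ L₁ L₂ s₁ s₂ c

/-- **DEFICIENT PART of the generic wall law at `(C, R₀)`** (v6.9): generic plate pairs that are NOT both Δ-steep
(walkers do not launch), or coverable with a table NOT flux-dominated (the zigzag deficit) — the orientation/table-deficient
remainder: LAYER-FLUX tables (MAX) + the (L3) certificate road of DECISION (xxxvi). -/
def BilayerWallDeficient (C R₀ : ℝ) : Prop :=
  ∀ (σ₁ σ₂ : ℤ → ℤ), IsHaggSeq σ₁ → IsHaggSeq σ₂ →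
    ∀ (L₁ L₂ : E3 ≃ₗᵢ[ℝ] E3) (s₁ s₂ : E3) (A₁ A₂ : ℤ → (E3 ≃ₗᵢ[ℝ] E3)) (u₁ u₂ : ℤ → E3),
    BilayerFramesAt L₁ s₁ σ₁ A₁ u₁ → BilayerFramesAt L₂ s₂ σ₂ A₂ u₂ →
    (∀ i j : ℤ, ¬ InResidualClass (A₁ i) (A₂ j) (u₁ i) (u₂ j)) →
    ∀ (c : ℤ → ℤ → ℝ) (m : ℤ → ℤ → E3), BilayerChargeAdmissible A₁ A₂ c m →
      (¬ (DeltaSteep L₁ e₃ ∧ DeltaSteep L₂ (-e₃)) ∨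
        (BarlowCoverable L₁ s₁ σ₁ L₂ s₂ σ₂ ∧ ¬ FluxDominated (Real.sqrt 2 / 2) L₁ σ₁ L₂ σ₂ c)) →
      BilayerWallAt C R₀ σ₁ σ₂ L₁ L₂ s₁ s₂ c

/-- The walker-covered part holds FROM plate thickness `R` on. -/
def BilayerWallWalkerCoveredFrom (R : ℝ) : Prop := ∀ R₀ : ℝ, R ≤ R₀ → ∃ C : ℝ, BilayerWallWalkerCovered C R₀

/-- The on-reach part holds FROM plate thickness `R` on. -/
def BilayerWallOnReachFrom (R : ℝ) : Prop := ∀ R₀ : ℝ, R ≤ R₀ → ∃ C : ℝ, BilayerWallOnReach C R₀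

/-- The deficient part holds FROM plate thickness `R` on. -/
def BilayerWallDeficientFrom (R : ℝ) : Prop := ∀ R₀ : ℝ, R ≤ R₀ → ∃ C : ℝ, BilayerWallDeficient C R₀

/-- **Glue (real proof, v6.9): walker-covered + on-reach + deficient ⇒ generic** — larger threshold, larger rim constant,
`by_cases` on Barlow coverability, flux domination and Δ-steepness. -/
theorem bilayerWallGeneric_of_three {R_C R_O R_D : ℝ} (hC1 : 1 ≤ R_C) (hC : BilayerWallWalkerCoveredFrom R_C)
    (hO : BilayerWallOnReachFrom R_O) (hD : BilayerWallDeficientFrom R_D) :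
    BilayerWallGenericFrom (max R_C (max R_O R_D)) := by
  classical
  intro R₀ hR₀
  have hR₀C : R_C ≤ R₀ := le_trans (le_max_left _ _) hR₀
  have hR₀O : R_O ≤ R₀ := le_trans (le_trans (le_max_left _ _) (le_max_right _ _)) hR₀
  have hR₀D : R_D ≤ R₀ := le_trans (le_trans (le_max_right _ _) (le_max_right _ _)) hR₀
  have hR₀0 : 0 ≤ R₀ := by linarith
  obtain ⟨C₁, hC₁⟩ := hC R₀ hR₀C
  obtain ⟨C₂, hC₂⟩ := hO R₀ hR₀O
  obtain ⟨C₃, hC₃⟩ := hD R₀ hR₀D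
  refine ⟨max C₁ (max C₂ C₃), ?_⟩
  intro σ₁ σ₂ hσ₁ hσ₂ L₁ L₂ s₁ s₂ A₁ A₂ u₁ u₂ hu₁ hu₂ hgen c m hadm
  by_cases hcov : BarlowCoverable L₁ s₁ σ₁ L₂ s₂ σ₂
  · by_cases hflux : FluxDominated (Real.sqrt 2 / 2) L₁ σ₁ L₂ σ₂ c
    · exact bilayerWallAt_mono hR₀0 (le_max_left _ _)
        (hC₁ σ₁ σ₂ hσ₁ hσ₂ L₁ L₂ s₁ s₂ A₁ A₂ u₁ u₂ hu₁ hu₂ hgen hcov c m hadm hflux)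
    · exact bilayerWallAt_mono hR₀0 (le_trans (le_max_right _ _) (le_max_right _ _))
        (hC₃ σ₁ σ₂ hσ₁ hσ₂ L₁ L₂ s₁ s₂ A₁ A₂ u₁ u₂ hu₁ hu₂ hgen c m hadm (Or.inr ⟨hcov, hflux⟩))
  · by_cases hsteep : DeltaSteep L₁ e₃ ∧ DeltaSteep L₂ (-e₃)
    · exact bilayerWallAt_mono hR₀0 (le_trans (le_max_left _ _) (le_max_right _ _))
        (hC₂ σ₁ σ₂ hσ₁ hσ₂ L₁ L₂ s₁ s₂ A₁ A₂ u₁ u₂ hu₁ hu₂ hgen hsteep.1 hsteep.2 hcov c m hadm)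
    · exact bilayerWallAt_mono hR₀0 (le_trans (le_max_right _ _) (le_max_right _ _))
        (hC₃ σ₁ σ₂ hσ₁ hσ₂ L₁ L₂ s₁ s₂ A₁ A₂ u₁ u₂ hu₁ hu₂ hgen c m hadm (Or.inl hsteep))

/-- Sanity (the pinned form UNFOLDS to F4's hypothesis list for the up-presentations): Barlow coverability gives the
steepness of both family slots. -/
theorem BarlowCoverable.famSlot_steep {L₁ L₂ : E3 ≃ₗᵢ[ℝ] E3} {s₁ s₂ : E3} {σ₁ σ₂ : ℤ → ℤ}
    (h : BarlowCoverable L₁ s₁ σ₁ L₂ s₂ σ₂) :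
    Real.sqrt 2 / 2 ≤ ⟪upFrame L₁ e₃ (famSlot L₁ e₃), e₃⟫_ℝ ∧
      Real.sqrt 2 / 2 ≤ ⟪upFrame L₂ (-e₃) (famSlot L₂ (-e₃)), -e₃⟫_ℝ :=
  ⟨famSlot_steep_of_deltaSteep L₁ e₃ h.1, famSlot_steep_of_deltaSteep L₂ (-e₃) h.2.1⟩

end Summit.Ventures.Crystal3D.Cruxes.TextureLiminf.TexShadow

end
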